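import Literature.NumberTheory.Sieve.GoldstonPintzYildirimTwoVarG
import Literature.NumberTheory.Sieve.GoldstonPintzYildirimShift
import Literature.Analysis.Complex.RectangleContourTools
import Literature.Analysis.Complex.VerticalLineShift
import Literature.Analysis.Complex.DoubleContourExpModel
import Literature.NumberTheory.LFunctions.PrimeLogSeries
import HarnessLib

/-!
# Goldston–Pintz–Yıldırım, *Primes in tuples I*, §8 Lemma 3 — set-up: `W`, `D`, the integrand, pointwise bounds

Trunk: NumberTheory / Sieve. First of the files proving (an explicit `o(1)` form of) GPY's
**Lemma 3** (D. A. Goldston, J. Pintz, C. Y. Yıldırım, *Primes in tuples. I*, Ann. of Math. 170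
(2009) = arXiv:math/0508185, §8, (8.1)–(8.6), pp. 16–17): the evaluation of

  `𝒯*_R(a,b,d,u,v) = (2πi)⁻² ∫_(1)∫_(1) D(s₁,s₂) R^{s₁+s₂} / (s₁^{u+1} s₂^{v+1} (s₁+s₂)^d) ds₁ds₂`,
  `D(s₁,s₂) = G(s₁,s₂) W(s₁+s₂)^d / (W(s₁)^a W(s₂)^b)`, `W(s) = sζ(1+s)` ((7.14), (8.1)–(8.2)),

as `C(u+v,u) (log R)^{u+v+d}/(u+v+d)! · G(0,0) + o((log R)^{u+v+d})` for `G` holomorphic and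
suitably bounded near the imaginary axes. This file fixes the objects and the pointwise analytic
facts; the contour decomposition is in the sequel files. Everything here is PROVED.

* `W(s) = sζ(1+s)` ((7.14)) is the tree's `Literature.NumberTheory.LFunctions.Nicolas.zetaOne`
  (`= riemannZeta₁(1+s)`, entire, `W(0) = 1`); here: `exists_norm_zetaOne_near_zero` (`1/2 ≤ |W| ≤ 3/2` near `0`), and the zero-free-region package
  `exists_zetaOne_bounds`: constants `0 < c̄ ≤ 1/100`, `C > 0` with, for `z ≠ 0`,
  `Re z ≥ −4c̄/log(|Im z|+3)`: `W(z) ≠ 0`, `|W(z)⁻¹| ≤ C log(|Im z|+3)/|z|`,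
  `|W(z)| ≤ 1 + C|z| log(|Im z|+3)` (from `ZetaClassicalRegion.exists_zeroFreeRegion_bounds`,
  GPY (5.3)–(5.4)); for `Re z > 0` the elementary `|W(z)⁻¹| ≤ (1+σ)/(σ|z|)`,
  `|W(z)|/|z| ≤ (1+σ)/σ`;
* `Literature.NumberTheory.Sieve.GPY.lemma3D`, `Literature.NumberTheory.Sieve.GPY.lemma3F`,
  `Literature.NumberTheory.Sieve.GPY.lemma3T` — `D`, the integrand of (8.1), and `𝒯*_R` as the
  iterated integral `(2π)⁻² ∫ (∫ ⋯ dt₁) dt₂` over `sⱼ = 1 + itⱼ` (the parametrisation of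
  `mainTR₂_eq_integral_integral`);
* `norm_lemma3F_le` — the pointwise bound
  `|F| ≤ |G| · (|W(s₁+s₂)|/|s₁+s₂|)^d · |W(s₁)⁻¹|^a |W(s₂)⁻¹|^b · R^{σ₁+σ₂}/(|s₁|^{u+1}|s₂|^{v+1})`;
* `differentiableAt_lemma3F_fst` / `_snd`, `continuousOn_lemma3F` — holomorphy of the integrand in
  each variable off the polar set `{s₁ = 0} ∪ {s₂ = 0} ∪ {s₁+s₂ = 0} ∪ {W(s₁) = 0} ∪ {W(s₂) = 0}`
  inside `Re sᵢ > −1/4`, and joint continuity;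
* `integral_inv_norm_pow_le` — `∫_ℝ dt/|σ+it|^{k+1} ≤ π/σ^k` (`σ > 0`, `k ≥ 1`), the majorant of
  all vertical-line estimates;
* `norm_lemma3F_le_of_re_pos`, `integrable_lemma3F_lines`, `integral_integral_swap_lines`,
  `integral_lemma3F_fst_line_eq`, `integral_lemma3F_snd_line_eq`,
  `integral_integral_lemma3F_lines_eq` — on pairs of lines `0 < Re sᵢ ≤ 1` the integrand has the
  product majorant `B K(σ₁,σ₂) R^{σ₁+σ₂} |s₁|^{−(u+1+a)} |s₂|^{−(v+1+b)}` (`a+u, b+v ≥ 1`), so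
  Fubini holds and both lines `(1)` of (8.1) may be moved to `Re s₁ = θ₁`, `Re s₂ = θ₂`,
  `0 < θᵢ ≤ 1`, crossing no poles (the first step of the contour argument in the form proved in
  the sequel: all the `R`-growth `|R^{s₁+s₂}| = R^{σ₁+σ₂}` is removed before any estimate).

## References

* D. A. Goldston, J. Pintz, C. Y. Yıldırım, *Primes in tuples. I*, Ann. of Math. (2) 170 (2009),
  819–862 = arXiv:math/0508185, §5 (5.3)–(5.4), §7 (7.13)–(7.15), §8 (8.1)–(8.3), Lemma 3.
  [cite: GoldstonPintzYildirim2009]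
* E. C. Titchmarsh, *The Theory of the Riemann Zeta-Function*, 2nd ed. (1986), Thm 3.11 and
  (3.11.8). [cite: Titchmarsh1986]
-/

noncomputable section

open Finset Complex Filter Topology MeasureTheory Set
open scoped Real

namespace Literature.NumberTheory.Sieve.GPY

open Literature.Analysis.Complex (rectBoundaryIntegral)
open Literature.NumberTheory.LFunctions.Nicolas (zetaOne zetaOne_zero differentiable_zetaOne zetaOne_of_ne_zero)

/-! ### `W(s) = s ζ(1+s)` ((7.14)) -/

/-! `W(s) = s ζ(1+s)` of GPY (7.14) is the tree's `Literature.NumberTheory.LFunctions.Nicolas.zetaOne`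
(`zetaOne s = riemannZeta₁ (1 + s)`, `PrimeLogSeries.lean`: `zetaOne_zero`, `differentiable_zetaOne`,
`zetaOne_of_ne_zero`), opened here as `zetaOne`. -/

/-- Near `0`: there is `ρ > 0` with `1/2 ≤ |W(s)| ≤ 3/2` for `|s| ≤ ρ` (continuity at `W(0) = 1`).
[folklore] -/
theorem exists_norm_zetaOne_near_zero :
    ∃ ρ : ℝ, 0 < ρ ∧ ∀ s : ℂ, ‖s‖ ≤ ρ → 1 / 2 ≤ ‖zetaOne s‖ ∧ ‖zetaOne s‖ ≤ 3 / 2 := by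
  have hc : ContinuousAt zetaOne 0 := differentiable_zetaOne.continuous.continuousAt
  rw [Metric.continuousAt_iff] at hc
  obtain ⟨δ, hδ, h⟩ := hc (1 / 2) one_half_pos
  refine ⟨δ / 2, by linarith, fun s hs => ?_⟩
  have hd : dist (zetaOne s) (zetaOne 0) < 1 / 2 := h (by rw [dist_zero_right]; linarith)
  rw [zetaOne_zero, dist_eq_norm] at hd
  have h1 : 1 - ‖zetaOne s‖ ≤ ‖zetaOne s - 1‖ := by
    have := norm_sub_norm_le (1 : ℂ) (zetaOne s); rwa [norm_one, norm_sub_rev] at this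
  have h2 : ‖zetaOne s‖ ≤ ‖zetaOne s - 1‖ + 1 := by
    have := norm_add_le (zetaOne s - 1) 1; rwa [sub_add_cancel, norm_one] at this
  constructor <;> linarith

/-- `W(s) ≠ 0` for `Re s > 0`. [folklore] -/
theorem zetaOne_ne_zero_of_re_pos {s : ℂ} (hs : 0 < s.re) : zetaOne s ≠ 0 := by
  have hs0 : s ≠ 0 := fun h => by rw [h] at hs; simp at hs
  rw [zetaOne_of_ne_zero hs0]
  exact mul_ne_zero hs0 (riemannZeta_one_add_ne_zero hs)

/-- For `Re s = σ > 0`: `|W(s)⁻¹| ≤ (1+σ)/(σ |s|)` (`|ζ(1+s)⁻¹| ≤ (1+σ)/σ`). [folklore] -/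
theorem norm_inv_zetaOne_le_of_re_pos {s : ℂ} (hs : 0 < s.re) :
    ‖(zetaOne s)⁻¹‖ ≤ (1 + s.re) / (s.re * ‖s‖) := by
  have hs0 : s ≠ 0 := fun h => by rw [h] at hs; simp at hs
  rw [zetaOne_of_ne_zero hs0, mul_inv, norm_mul, norm_inv]
  have h := norm_inv_riemannZeta_one_add_le hs
  have hn : 0 < ‖s‖ := norm_pos_iff.2 hs0
  calc ‖s‖⁻¹ * ‖(riemannZeta (1 + s))⁻¹‖ ≤ ‖s‖⁻¹ * ((1 + s.re) / s.re) :=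
        mul_le_mul_of_nonneg_left h (by positivity)
    _ = (1 + s.re) / (s.re * ‖s‖) := by field_simp

/-- For `Re s = σ > 0`: `|W(s)| ≤ (1+σ)|s|/σ` (`|ζ(1+s)| ≤ (1+σ)/σ`). [folklore] -/
theorem norm_zetaOne_le_of_re_pos {s : ℂ} (hs : 0 < s.re) :
    ‖zetaOne s‖ ≤ (1 + s.re) / s.re * ‖s‖ := by
  have hs0 : s ≠ 0 := fun h => by rw [h] at hs; simp at hs
  rw [zetaOne_of_ne_zero hs0, norm_mul]
  have h := Literature.NumberTheory.LFunctions.ZetaClassicalRegion.norm_riemannZeta_le_of_one_lt_re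
    (s := 1 + s) (by simp only [add_re, one_re]; linarith)
  simp only [add_re, one_re, add_sub_cancel_left] at h
  calc ‖s‖ * ‖riemannZeta (1 + s)‖ ≤ ‖s‖ * ((1 + s.re) / s.re) :=
        mul_le_mul_of_nonneg_left h (norm_nonneg _)
    _ = (1 + s.re) / s.re * ‖s‖ := by ring

/-- **The zero-free-region package for `W`** (GPY (5.3)–(5.4) transported to `s = 1 + z`): there
are `0 < c̄ ≤ 1/100` and `C > 0` such that for `z ≠ 0` with `Re z ≥ −4c̄/log(|Im z|+3)`:
`W(z) ≠ 0`, `|W(z)⁻¹| ≤ C log(|Im z|+3)/|z|` and `|W(z)| ≤ 1 + C|z| log(|Im z|+3)`.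
[cite: GoldstonPintzYildirim2009, Section 5 eq. 5.4] -/
theorem exists_zetaOne_bounds :
    ∃ cbar C : ℝ, 0 < cbar ∧ cbar ≤ 1 / 100 ∧ 0 < C ∧ ∀ z : ℂ, z ≠ 0 →
      -(4 * cbar / Real.log (|z.im| + 3)) ≤ z.re →
        zetaOne z ≠ 0 ∧ ‖(zetaOne z)⁻¹‖ ≤ C * Real.log (|z.im| + 3) / ‖z‖ ∧
          ‖zetaOne z‖ ≤ 1 + C * ‖z‖ * Real.log (|z.im| + 3) := by
  obtain ⟨cbar, hc0, hc1, C, hC, hP⟩ := Literature.NumberTheory.LFunctions.ZetaClassicalRegion.exists_zeroFreeRegion_bounds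
  refine ⟨cbar, C, hc0, hc1, hC, fun z hz hσ => ?_⟩
  have h1 : (1 + z) ≠ 1 := fun h => hz (by linear_combination h)
  have h := hP (1 + z) h1 (by simp only [add_re, one_re, add_im, one_im, zero_add]; linarith)
  simp only [add_im, one_im, zero_add, add_sub_cancel_left] at h
  obtain ⟨hne, hsub, hinv, -⟩ := h
  have hn : 0 < ‖z‖ := norm_pos_iff.2 hz
  refine ⟨?_, ?_, ?_⟩
  · rw [zetaOne_of_ne_zero hz]; exact mul_ne_zero hz hne
  · rw [zetaOne_of_ne_zero hz, mul_inv, norm_mul, norm_inv]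
    calc ‖z‖⁻¹ * ‖(riemannZeta (1 + z))⁻¹‖ ≤ ‖z‖⁻¹ * (C * Real.log (|z.im| + 3)) :=
          mul_le_mul_of_nonneg_left hinv (by positivity)
      _ = C * Real.log (|z.im| + 3) / ‖z‖ := by field_simp
  · rw [zetaOne_of_ne_zero hz]
    have e : z * riemannZeta (1 + z) = 1 + z * (riemannZeta (1 + z) - 1 / z) := by field_simp; ring
    rw [e]
    calc ‖1 + z * (riemannZeta (1 + z) - 1 / z)‖ ≤ ‖(1 : ℂ)‖ + ‖z * (riemannZeta (1 + z) - 1 / z)‖ :=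
          norm_add_le _ _
      _ = 1 + ‖z‖ * ‖riemannZeta (1 + z) - 1 / z‖ := by rw [norm_one, norm_mul]
      _ ≤ 1 + ‖z‖ * (C * Real.log (|z.im| + 3)) := by gcongr
      _ = 1 + C * ‖z‖ * Real.log (|z.im| + 3) := by ring

/-! ### `D`, the integrand of (8.1), and `𝒯*_R` -/

/-- GPY (8.2): `D(s₁,s₂) = G(s₁,s₂) W(s₁+s₂)^d / (W(s₁)^a W(s₂)^b)` for a given `G`.
[cite: GoldstonPintzYildirim2009, Section 8 eq. 8.2] -/
def lemma3D (G : ℂ → ℂ → ℂ) (a b d : ℕ) (s₁ s₂ : ℂ) : ℂ :=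
  G s₁ s₂ * zetaOne (s₁ + s₂) ^ d / (zetaOne s₁ ^ a * zetaOne s₂ ^ b)

/-- The integrand of GPY (8.1): `D(s₁,s₂) R^{s₁+s₂} / (s₁^{u+1} s₂^{v+1} (s₁+s₂)^d)`.
[cite: GoldstonPintzYildirim2009, Section 8 eq. 8.1] -/
def lemma3F (G : ℂ → ℂ → ℂ) (R : ℝ) (a b d u v : ℕ) (s₁ s₂ : ℂ) : ℂ :=
  lemma3D G a b d s₁ s₂ * (R : ℂ) ^ (s₁ + s₂) / (s₁ ^ (u + 1) * s₂ ^ (v + 1) * (s₁ + s₂) ^ d)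

/-- GPY (8.1): `𝒯*_R(a,b,d,u,v) = (2πi)⁻² ∫_(1)∫_(1) D R^{s₁+s₂} s₁^{−u−1} s₂^{−v−1} (s₁+s₂)^{−d} ds₁ds₂`,
as the iterated integral `(2π)⁻² ∫ (∫ F(1+it₁, 1+it₂) dt₁) dt₂` (`dsⱼ = i dtⱼ`; the same
parametrisation and order as `mainTR₂_eq_integral_integral`).
[cite: GoldstonPintzYildirim2009, Section 8 eq. 8.1] -/
def lemma3T (G : ℂ → ℂ → ℂ) (R : ℝ) (a b d u v : ℕ) : ℂ :=
  (1 / (2 * Real.pi) ^ 2 : ℂ) *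
    ∫ t₂ : ℝ, ∫ t₁ : ℝ, lemma3F G R a b d u v (((1 : ℝ) : ℂ) + t₁ * I) (((1 : ℝ) : ℂ) + t₂ * I)

/-- `D(0,0) = G(0,0)` (`W(0) = 1`). [cite: GoldstonPintzYildirim2009, Section 8 eq. 8.5] -/
theorem lemma3D_zero_zero (G : ℂ → ℂ → ℂ) (a b d : ℕ) : lemma3D G a b d 0 0 = G 0 0 := by
  simp [lemma3D, zetaOne_zero]

/-! ### The pointwise bound -/

/-- **Pointwise bound for the integrand**: for `R > 0`, `s₁, s₂, s₁ + s₂ ≠ 0`,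
`|F(s₁,s₂)| ≤ |G(s₁,s₂)| (|W(s₁+s₂)|/|s₁+s₂|)^d |W(s₁)⁻¹|^a |W(s₂)⁻¹|^b R^{σ₁+σ₂} / (|s₁|^{u+1} |s₂|^{v+1})`
(an equality, in fact). [cite: GoldstonPintzYildirim2009, Section 8 eq. 8.1] -/
theorem norm_lemma3F_le (G : ℂ → ℂ → ℂ) {R : ℝ} (hR : 0 < R) (a b d u v : ℕ) {s₁ s₂ : ℂ}
    (h1 : s₁ ≠ 0) (h2 : s₂ ≠ 0) (h12 : s₁ + s₂ ≠ 0) (hW1 : zetaOne s₁ ≠ 0) (hW2 : zetaOne s₂ ≠ 0) :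
    ‖lemma3F G R a b d u v s₁ s₂‖ ≤
      ‖G s₁ s₂‖ * (‖zetaOne (s₁ + s₂)‖ / ‖s₁ + s₂‖) ^ d * ‖(zetaOne s₁)⁻¹‖ ^ a * ‖(zetaOne s₂)⁻¹‖ ^ b *
        R ^ (s₁.re + s₂.re) / (‖s₁‖ ^ (u + 1) * ‖s₂‖ ^ (v + 1)) := by
  have hn1 : ‖s₁‖ ≠ 0 := norm_ne_zero_iff.2 h1
  have hn2 : ‖s₂‖ ≠ 0 := norm_ne_zero_iff.2 h2
  have hn12 : ‖s₁ + s₂‖ ≠ 0 := norm_ne_zero_iff.2 h12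
  have hw1 : ‖zetaOne s₁‖ ≠ 0 := norm_ne_zero_iff.2 hW1
  have hw2 : ‖zetaOne s₂‖ ≠ 0 := norm_ne_zero_iff.2 hW2
  unfold lemma3F lemma3D
  simp only [norm_div, norm_mul, norm_pow, norm_inv, Complex.norm_cpow_eq_rpow_re_of_pos hR, add_re]
  apply le_of_eq
  rw [div_pow, inv_pow, inv_pow]
  field_simp

/-! ### Holomorphy and continuity of the integrand -/

/-- `D(·, s₂)`-type building block: for fixed `s₂`, `s₁ ↦ G(s₁,s₂)` is differentiable at `s₁` when
`G` is jointly holomorphic on `Ω` and `(s₁,s₂) ∈ Ω`. [folklore] -/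
theorem differentiableAt_G_fst {G : ℂ → ℂ → ℂ}
    (hG : DifferentiableOn ℂ (fun z : ℂ × ℂ => G z.1 z.2) G₂Region) {s₁ s₂ : ℂ}
    (h1 : -1 / 4 < s₁.re) (h2 : -1 / 4 < s₂.re) :
    DifferentiableAt ℂ (fun s : ℂ => G s s₂) s₁ := by
  have h := hG.differentiableAt (x := (s₁, s₂)) (isOpen_G₂Region.mem_nhds ⟨h1, h2⟩)
  have hi : DifferentiableAt ℂ (fun s : ℂ => (s, s₂)) s₁ :=
    differentiableAt_id.prodMk (differentiableAt_const _)
  exact h.comp s₁ hi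

/-- Same in the second variable. [folklore] -/
theorem differentiableAt_G_snd {G : ℂ → ℂ → ℂ}
    (hG : DifferentiableOn ℂ (fun z : ℂ × ℂ => G z.1 z.2) G₂Region) {s₁ s₂ : ℂ}
    (h1 : -1 / 4 < s₁.re) (h2 : -1 / 4 < s₂.re) :
    DifferentiableAt ℂ (fun s : ℂ => G s₁ s) s₂ := by
  have h := hG.differentiableAt (x := (s₁, s₂)) (isOpen_G₂Region.mem_nhds ⟨h1, h2⟩)
  have hi : DifferentiableAt ℂ (fun s : ℂ => (s₁, s)) s₂ :=
    (differentiableAt_const _).prodMk differentiableAt_id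
  exact h.comp s₂ hi

/-- **Holomorphy in `s₁`**: for fixed `s₂`, the integrand is complex differentiable at `s₁`
provided `Re s₁, Re s₂ > −1/4`, `W(s₁) ≠ 0`, `W(s₂) ≠ 0`, `s₁ ≠ 0`, `s₂ ≠ 0`, `s₁ + s₂ ≠ 0`
(`R > 0`). [cite: GoldstonPintzYildirim2009, Section 8 eq. 8.1] -/
theorem differentiableAt_lemma3F_fst {G : ℂ → ℂ → ℂ}
    (hG : DifferentiableOn ℂ (fun z : ℂ × ℂ => G z.1 z.2) G₂Region) {R : ℝ} (hR : 0 < R)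
    (a b d u v : ℕ) {s₁ s₂ : ℂ} (h1 : -1 / 4 < s₁.re) (h2 : -1 / 4 < s₂.re)
    (hW1 : zetaOne s₁ ≠ 0) (hW2 : zetaOne s₂ ≠ 0) (hs1 : s₁ ≠ 0) (hs2 : s₂ ≠ 0) (hs12 : s₁ + s₂ ≠ 0) :
    DifferentiableAt ℂ (fun s : ℂ => lemma3F G R a b d u v s s₂) s₁ := by
  have hGd := differentiableAt_G_fst hG h1 h2
  have hWs : DifferentiableAt ℂ (fun s : ℂ => zetaOne (s + s₂)) s₁ :=
    (differentiable_zetaOne.differentiableAt).comp s₁ (differentiableAt_id.add_const s₂)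
  have hW1d : DifferentiableAt ℂ zetaOne s₁ := differentiable_zetaOne.differentiableAt
  have hRd : DifferentiableAt ℂ (fun s : ℂ => (R : ℂ) ^ (s + s₂)) s₁ :=
    (differentiableAt_id.add_const s₂).const_cpow (Or.inl (by exact_mod_cast hR.ne'))
  unfold lemma3F lemma3D
  refine ((((hGd.mul (hWs.pow d)).div ((hW1d.pow a).mul (differentiableAt_const _))
    (mul_ne_zero (pow_ne_zero _ hW1) (pow_ne_zero _ hW2))).mul hRd).div ?_ ?_)
  · exact ((differentiableAt_id.pow _).mul (differentiableAt_const _)).mul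
      ((differentiableAt_id.add_const s₂).pow _)
  · exact mul_ne_zero (mul_ne_zero (pow_ne_zero _ hs1) (pow_ne_zero _ hs2)) (pow_ne_zero _ hs12)

/-- **Holomorphy in `s₂`** (same hypotheses). [cite: GoldstonPintzYildirim2009, Section 8 eq. 8.1] -/
theorem differentiableAt_lemma3F_snd {G : ℂ → ℂ → ℂ}
    (hG : DifferentiableOn ℂ (fun z : ℂ × ℂ => G z.1 z.2) G₂Region) {R : ℝ} (hR : 0 < R)
    (a b d u v : ℕ) {s₁ s₂ : ℂ} (h1 : -1 / 4 < s₁.re) (h2 : -1 / 4 < s₂.re)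
    (hW1 : zetaOne s₁ ≠ 0) (hW2 : zetaOne s₂ ≠ 0) (hs1 : s₁ ≠ 0) (hs2 : s₂ ≠ 0) (hs12 : s₁ + s₂ ≠ 0) :
    DifferentiableAt ℂ (fun s : ℂ => lemma3F G R a b d u v s₁ s) s₂ := by
  have hGd := differentiableAt_G_snd hG h1 h2
  have hWs : DifferentiableAt ℂ (fun s : ℂ => zetaOne (s₁ + s)) s₂ :=
    (differentiable_zetaOne.differentiableAt).comp s₂ (differentiableAt_id.const_add s₁)
  have hW2d : DifferentiableAt ℂ zetaOne s₂ := differentiable_zetaOne.differentiableAt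
  have hRd : DifferentiableAt ℂ (fun s : ℂ => (R : ℂ) ^ (s₁ + s)) s₂ :=
    (differentiableAt_id.const_add s₁).const_cpow (Or.inl (by exact_mod_cast hR.ne'))
  unfold lemma3F lemma3D
  refine ((((hGd.mul (hWs.pow d)).div ((differentiableAt_const _).mul (hW2d.pow b))
    (mul_ne_zero (pow_ne_zero _ hW1) (pow_ne_zero _ hW2))).mul hRd).div ?_ ?_)
  · exact (((differentiableAt_const _).mul (differentiableAt_id.pow _))).mul
      ((differentiableAt_id.const_add s₁).pow _)
  · exact mul_ne_zero (mul_ne_zero (pow_ne_zero _ hs1) (pow_ne_zero _ hs2)) (pow_ne_zero _ hs12)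

/-- The "good set" of the integrand: `Re sᵢ > −1/4`, `W(sᵢ) ≠ 0`, `sᵢ ≠ 0`, `s₁ + s₂ ≠ 0`.
[cite: GoldstonPintzYildirim2009, Section 8 eq. 8.1] -/
def lemma3Good : Set (ℂ × ℂ) :=
  {z | -1 / 4 < z.1.re ∧ -1 / 4 < z.2.re ∧ zetaOne z.1 ≠ 0 ∧ zetaOne z.2 ≠ 0 ∧ z.1 ≠ 0 ∧ z.2 ≠ 0 ∧
    z.1 + z.2 ≠ 0}

/-- **Joint continuity** of the integrand on the good set (for measurability and for the
parametric integrals). [cite: GoldstonPintzYildirim2009, Section 8 eq. 8.1] -/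
theorem continuousOn_lemma3F {G : ℂ → ℂ → ℂ}
    (hG : DifferentiableOn ℂ (fun z : ℂ × ℂ => G z.1 z.2) G₂Region) {R : ℝ} (hR : 0 < R)
    (a b d u v : ℕ) :
    ContinuousOn (fun z : ℂ × ℂ => lemma3F G R a b d u v z.1 z.2) lemma3Good := by
  have hGc : ContinuousOn (fun z : ℂ × ℂ => G z.1 z.2) lemma3Good :=
    hG.continuousOn.mono fun z hz => ⟨hz.1, hz.2.1⟩
  have hWc : Continuous zetaOne := differentiable_zetaOne.continuous
  unfold lemma3F lemma3D
  refine ContinuousOn.div ?_ ?_ ?_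
  · refine ContinuousOn.mul (ContinuousOn.div ?_ ?_ ?_) ?_
    · exact hGc.mul ((hWc.comp (continuous_fst.add continuous_snd)).continuousOn.pow _)
    · exact ((hWc.comp continuous_fst).continuousOn.pow _).mul
        ((hWc.comp continuous_snd).continuousOn.pow _)
    · intro z hz
      exact mul_ne_zero (pow_ne_zero _ hz.2.2.1) (pow_ne_zero _ hz.2.2.2.1)
    · refine ContinuousOn.const_cpow (f := fun z : ℂ × ℂ => z.1 + z.2) ?_ (Or.inl ?_)
      · exact (continuous_fst.add continuous_snd).continuousOn
      · exact_mod_cast hR.ne'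
  · exact (((continuous_fst.pow _).mul (continuous_snd.pow _)).mul
      ((continuous_fst.add continuous_snd).pow _)).continuousOn
  · intro z hz
    exact mul_ne_zero (mul_ne_zero (pow_ne_zero _ hz.2.2.2.2.1) (pow_ne_zero _ hz.2.2.2.2.2.1))
      (pow_ne_zero _ hz.2.2.2.2.2.2)

/-! ### The vertical-line majorant -/

/-- **`∫_ℝ dt/|σ+it|^{k+1} ≤ π/σ^k`** for `σ > 0`, `k ≥ 1`, with integrability of the integrand
(from `inv_norm_pow_le` and `integral_inv_sq_add_sq` of `GoldstonPintzYildirimShift`). [folklore] -/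
theorem integral_inv_norm_pow_le {σ : ℝ} (hσ : 0 < σ) {k : ℕ} (hk : 1 ≤ k) :
    Integrable (fun t : ℝ => (‖(σ : ℂ) + t * I‖ ^ (k + 1))⁻¹) ∧
      ∫ t : ℝ, (‖(σ : ℂ) + t * I‖ ^ (k + 1))⁻¹ ≤ Real.pi / σ ^ k := by
  have hmaj : Integrable fun t : ℝ => (|σ| ^ (k - 1))⁻¹ * (σ ^ 2 + t ^ 2)⁻¹ :=
    (integrable_inv_sq_add_sq hσ).const_mul _
  have hcont : Continuous fun t : ℝ => (‖(σ : ℂ) + t * I‖ ^ (k + 1))⁻¹ := by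
    refine Continuous.inv₀ (by fun_prop) fun t => pow_ne_zero _ (norm_ne_zero_iff.2 ?_)
    intro h; have := congrArg Complex.re h; simp [hσ.ne'] at this
  have hint : Integrable fun t : ℝ => (‖(σ : ℂ) + t * I‖ ^ (k + 1))⁻¹ :=
    hmaj.mono' hcont.aestronglyMeasurable (Eventually.of_forall fun t => by
      rw [Real.norm_eq_abs, abs_of_nonneg (by positivity)]
      exact inv_norm_pow_le hσ.ne' hk t)
  refine ⟨hint, ?_⟩
  calc ∫ t : ℝ, (‖(σ : ℂ) + t * I‖ ^ (k + 1))⁻¹ ≤ ∫ t : ℝ, (|σ| ^ (k - 1))⁻¹ * (σ ^ 2 + t ^ 2)⁻¹ :=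
        integral_mono hint hmaj fun t => inv_norm_pow_le hσ.ne' hk t
    _ = (|σ| ^ (k - 1))⁻¹ * (Real.pi / σ) := by
        rw [MeasureTheory.integral_const_mul, integral_inv_sq_add_sq hσ]
    _ = Real.pi / σ ^ k := by
        rw [abs_of_pos hσ]
        obtain ⟨j, rfl⟩ : ∃ j, k = j + 1 := ⟨k - 1, by omega⟩
        simp only [add_tsub_cancel_right, pow_succ]
        field_simp

/-! ### The integrand on pairs of vertical lines in `Re s > 0`: majorant, Fubini, line shifts

For `0 < Re s₁ = σ₁ ≤ 1`, `0 < Re s₂ = σ₂ ≤ 1` no singularity is met, `|W(s)⁻¹| ≤ 2/(σ|s|)`,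
`|W(s₁+s₂)|/|s₁+s₂| ≤ 3/(σ₁+σ₂)`, so `|F| ≤ B K R^{σ₁+σ₂} |s₁|^{−(u+1+a)} |s₂|^{−(v+1+b)}`:
a product majorant, integrable as soon as `a + u ≥ 1`, `b + v ≥ 1`. Hence Fubini applies, and
each line may be moved within `(0, 1]` (no poles are crossed): the two lines `(1)` of (8.1) are
moved to `Re s₁ = θ₁`, `Re s₂ = θ₂` (the first step of the proof of Lemma 3 in the form used
here). -/

section Lines

variable {G : ℂ → ℂ → ℂ} {B κ : ℝ}

/-- The constant `K(σ₁,σ₂) = (3/(σ₁+σ₂))^d (2/σ₁)^a (2/σ₂)^b` of the product majorant.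
[cite: GoldstonPintzYildirim2009, Section 8 eq. 8.1] -/
def lineConst (σ₁ σ₂ : ℝ) (a b d : ℕ) : ℝ := (3 / (σ₁ + σ₂)) ^ d * (2 / σ₁) ^ a * (2 / σ₂) ^ b

/-- `K ≥ 0` for `σ₁, σ₂ > 0`. [folklore] -/
theorem lineConst_nonneg {σ₁ σ₂ : ℝ} (h1 : 0 < σ₁) (h2 : 0 < σ₂) (a b d : ℕ) :
    0 ≤ lineConst σ₁ σ₂ a b d := by unfold lineConst; positivity

/-- **Pointwise bound on lines in `0 < Re sᵢ ≤ 1`**: if `|G| ≤ B` at `(s₁,s₂)`, then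
`|F(s₁,s₂)| ≤ B K(σ₁,σ₂) R^{σ₁+σ₂} / (|s₁|^{u+1+a} |s₂|^{v+1+b})`.
[cite: GoldstonPintzYildirim2009, Section 8 eq. 8.1] -/
theorem norm_lemma3F_le_of_re_pos {R : ℝ} (hR : 0 < R) (a b d u v : ℕ) {s₁ s₂ : ℂ}
    (h1 : 0 < s₁.re) (h1' : s₁.re ≤ 1) (h2 : 0 < s₂.re) (h2' : s₂.re ≤ 1) (hB0 : 0 ≤ B)
    (hGB : ‖G s₁ s₂‖ ≤ B) :
    ‖lemma3F G R a b d u v s₁ s₂‖ ≤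
      B * lineConst s₁.re s₂.re a b d * R ^ (s₁.re + s₂.re) *
        ((‖s₁‖ ^ (u + 1 + a))⁻¹ * (‖s₂‖ ^ (v + 1 + b))⁻¹) := by
  have hs1 : s₁ ≠ 0 := fun h => by rw [h] at h1; simp at h1
  have hs2 : s₂ ≠ 0 := fun h => by rw [h] at h2; simp at h2
  have h12re : 0 < (s₁ + s₂).re := by simp only [add_re]; linarith
  have hs12 : s₁ + s₂ ≠ 0 := fun h => by rw [h] at h12re; simp at h12re
  have hW1 := zetaOne_ne_zero_of_re_pos h1
  have hW2 := zetaOne_ne_zero_of_re_pos h2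
  have hn1 : 0 < ‖s₁‖ := norm_pos_iff.2 hs1
  have hn2 : 0 < ‖s₂‖ := norm_pos_iff.2 hs2
  have hn12 : 0 < ‖s₁ + s₂‖ := norm_pos_iff.2 hs12
  -- the three `W`-bounds
  have e12 : ‖zetaOne (s₁ + s₂)‖ / ‖s₁ + s₂‖ ≤ 3 / (s₁.re + s₂.re) := by
    rw [div_le_iff₀ hn12]
    refine (norm_zetaOne_le_of_re_pos h12re).trans ?_
    simp only [add_re]
    rw [div_mul_eq_mul_div, div_mul_eq_mul_div]
    refine div_le_div_of_nonneg_right ?_ (by linarith)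
    nlinarith [hn12]
  have e1 : ‖(zetaOne s₁)⁻¹‖ ≤ 2 / (s₁.re * ‖s₁‖) :=
    (norm_inv_zetaOne_le_of_re_pos h1).trans (div_le_div_of_nonneg_right (by linarith) (by positivity))
  have e2 : ‖(zetaOne s₂)⁻¹‖ ≤ 2 / (s₂.re * ‖s₂‖) :=
    (norm_inv_zetaOne_le_of_re_pos h2).trans (div_le_div_of_nonneg_right (by linarith) (by positivity))
  refine (norm_lemma3F_le G hR a b d u v hs1 hs2 hs12 hW1 hW2).trans ?_
  have hp12 : (‖zetaOne (s₁ + s₂)‖ / ‖s₁ + s₂‖) ^ d ≤ (3 / (s₁.re + s₂.re)) ^ d :=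
    pow_le_pow_left₀ (by positivity) e12 d
  have hp1 : ‖(zetaOne s₁)⁻¹‖ ^ a ≤ (2 / (s₁.re * ‖s₁‖)) ^ a := pow_le_pow_left₀ (by positivity) e1 a
  have hp2 : ‖(zetaOne s₂)⁻¹‖ ^ b ≤ (2 / (s₂.re * ‖s₂‖)) ^ b := pow_le_pow_left₀ (by positivity) e2 b
  -- the numerator
  have hN : ‖G s₁ s₂‖ * (‖zetaOne (s₁ + s₂)‖ / ‖s₁ + s₂‖) ^ d * ‖(zetaOne s₁)⁻¹‖ ^ a * ‖(zetaOne s₂)⁻¹‖ ^ b ≤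
      B * (3 / (s₁.re + s₂.re)) ^ d * (2 / (s₁.re * ‖s₁‖)) ^ a * (2 / (s₂.re * ‖s₂‖)) ^ b :=
    mul_le_mul (mul_le_mul (mul_le_mul hGB hp12 (by positivity) hB0) hp1 (by positivity)
      (by positivity)) hp2 (by positivity) (by positivity)
  have hrest : 0 ≤ R ^ (s₁.re + s₂.re) / (‖s₁‖ ^ (u + 1) * ‖s₂‖ ^ (v + 1)) := by positivity
  calc ‖G s₁ s₂‖ * (‖zetaOne (s₁ + s₂)‖ / ‖s₁ + s₂‖) ^ d * ‖(zetaOne s₁)⁻¹‖ ^ a * ‖(zetaOne s₂)⁻¹‖ ^ b *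
        R ^ (s₁.re + s₂.re) / (‖s₁‖ ^ (u + 1) * ‖s₂‖ ^ (v + 1))
      = (‖G s₁ s₂‖ * (‖zetaOne (s₁ + s₂)‖ / ‖s₁ + s₂‖) ^ d * ‖(zetaOne s₁)⁻¹‖ ^ a * ‖(zetaOne s₂)⁻¹‖ ^ b) *
        (R ^ (s₁.re + s₂.re) / (‖s₁‖ ^ (u + 1) * ‖s₂‖ ^ (v + 1))) := by ring
    _ ≤ (B * (3 / (s₁.re + s₂.re)) ^ d * (2 / (s₁.re * ‖s₁‖)) ^ a * (2 / (s₂.re * ‖s₂‖)) ^ b) *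
        (R ^ (s₁.re + s₂.re) / (‖s₁‖ ^ (u + 1) * ‖s₂‖ ^ (v + 1))) :=
        mul_le_mul_of_nonneg_right hN hrest
    _ = B * lineConst s₁.re s₂.re a b d * R ^ (s₁.re + s₂.re) *
        ((‖s₁‖ ^ (u + 1 + a))⁻¹ * (‖s₂‖ ^ (v + 1 + b))⁻¹) := by
        have hn1' : ‖s₁‖ ≠ 0 := hn1.ne'
        have hn2' : ‖s₂‖ ≠ 0 := hn2.ne'
        have hσ1 : s₁.re ≠ 0 := h1.ne'
        have hσ2 : s₂.re ≠ 0 := h2.ne'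
        have hσ12 : s₁.re + s₂.re ≠ 0 := by linarith
        unfold lineConst
        simp only [div_pow, mul_pow, pow_add]
        field_simp

/-- `σ + it ≠ 0` for `σ ≠ 0`. [folklore] -/
theorem line_ne_zero {σ : ℝ} (hσ : σ ≠ 0) (t : ℝ) : (σ : ℂ) + t * I ≠ 0 := fun h => by
  have := congrArg Complex.re h; simp [hσ] at this

/-- Points of a pair of lines in `Re s > 0` are good. [folklore] -/
theorem mem_lemma3Good_lines {σ₁ σ₂ : ℝ} (h1 : 0 < σ₁) (h2 : 0 < σ₂) (t₁ t₂ : ℝ) :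
    (((σ₁ : ℂ) + t₁ * I), ((σ₂ : ℂ) + t₂ * I)) ∈ lemma3Good := by
  refine ⟨by rw [Literature.NumberTheory.LFunctions.MertensBoundRH.re_line]; linarith, by rw [Literature.NumberTheory.LFunctions.MertensBoundRH.re_line]; linarith,
    zetaOne_ne_zero_of_re_pos (by rw [Literature.NumberTheory.LFunctions.MertensBoundRH.re_line]; exact h1), zetaOne_ne_zero_of_re_pos (by rw [Literature.NumberTheory.LFunctions.MertensBoundRH.re_line]; exact h2),
    line_ne_zero h1.ne' t₁, line_ne_zero h2.ne' t₂, ?_⟩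
  intro h
  have := congrArg Complex.re h
  simp at this
  linarith

/-- On the lines `Re s₁ = σ₁`, `Re s₂ = σ₂` (`0 < σᵢ ≤ 1`) the integrand is continuous in `(t₁, t₂)`.
[cite: GoldstonPintzYildirim2009, Section 8 eq. 8.1] -/
theorem continuous_lemma3F_lines (hG : DifferentiableOn ℂ (fun z : ℂ × ℂ => G z.1 z.2) G₂Region)
    {R : ℝ} (hR : 0 < R) (a b d u v : ℕ) {σ₁ σ₂ : ℝ} (h1 : 0 < σ₁) (h2 : 0 < σ₂) :
    Continuous fun p : ℝ × ℝ =>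
      lemma3F G R a b d u v ((σ₁ : ℂ) + p.1 * I) ((σ₂ : ℂ) + p.2 * I) := by
  have hemb : Continuous fun p : ℝ × ℝ => (((σ₁ : ℂ) + p.1 * I), ((σ₂ : ℂ) + p.2 * I)) := by
    fun_prop
  have heq : (fun p : ℝ × ℝ => lemma3F G R a b d u v ((σ₁ : ℂ) + p.1 * I) ((σ₂ : ℂ) + p.2 * I)) =
      (fun z : ℂ × ℂ => lemma3F G R a b d u v z.1 z.2) ∘
        fun p : ℝ × ℝ => (((σ₁ : ℂ) + p.1 * I), ((σ₂ : ℂ) + p.2 * I)) := rfl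
  rw [heq]
  exact (continuousOn_lemma3F hG hR a b d u v).comp_continuous hemb
    (fun p => mem_lemma3Good_lines h1 h2 p.1 p.2)

/-- **Integrability on a pair of lines** `Re s₁ = σ₁`, `Re s₂ = σ₂` (`0 < σᵢ ≤ 1`), when
`|G| ≤ B` there and `a + u ≥ 1`, `b + v ≥ 1` (product majorant).
[cite: GoldstonPintzYildirim2009, Section 8 eq. 8.1] -/
theorem integrable_lemma3F_lines (hG : DifferentiableOn ℂ (fun z : ℂ × ℂ => G z.1 z.2) G₂Region)
    {R : ℝ} (hR : 0 < R) {a b d u v : ℕ} (hau : 1 ≤ a + u) (hbv : 1 ≤ b + v) {σ₁ σ₂ : ℝ}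
    (h1 : 0 < σ₁) (h1' : σ₁ ≤ 1) (h2 : 0 < σ₂) (h2' : σ₂ ≤ 1) (hB0 : 0 ≤ B)
    (hGB : ∀ t₁ t₂ : ℝ, ‖G ((σ₁ : ℂ) + t₁ * I) ((σ₂ : ℂ) + t₂ * I)‖ ≤ B) :
    Integrable (fun p : ℝ × ℝ => lemma3F G R a b d u v ((σ₁ : ℂ) + p.1 * I) ((σ₂ : ℂ) + p.2 * I))
      (volume.prod volume) := by
  obtain ⟨hi1, -⟩ := integral_inv_norm_pow_le h1 (k := u + a) (by omega)
  obtain ⟨hi2, -⟩ := integral_inv_norm_pow_le h2 (k := v + b) (by omega)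
  have hmaj := (hi1.mul_prod hi2).const_mul (B * lineConst σ₁ σ₂ a b d * R ^ (σ₁ + σ₂))
  refine hmaj.mono' (continuous_lemma3F_lines hG hR a b d u v h1 h2).aestronglyMeasurable
    (Eventually.of_forall fun p => ?_)
  have r1 : ((σ₁ : ℂ) + p.1 * I).re = σ₁ := by simp
  have r2 : ((σ₂ : ℂ) + p.2 * I).re = σ₂ := by simp
  have h := norm_lemma3F_le_of_re_pos (G := G) hR a b d u v (s₁ := (σ₁ : ℂ) + p.1 * I)
    (s₂ := (σ₂ : ℂ) + p.2 * I) (by rw [r1]; exact h1) (by rw [r1]; exact h1') (by rw [r2]; exact h2)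
    (by rw [r2]; exact h2') hB0 (hGB p.1 p.2)
  rw [r1, r2] at h
  refine h.trans (le_of_eq ?_)
  simp only [show u + 1 + a = u + a + 1 by ring, show v + 1 + b = v + b + 1 by ring]

/-- **Fubini** on a pair of lines in `0 < Re sᵢ ≤ 1`.
[cite: GoldstonPintzYildirim2009, Section 8 eq. 8.1] -/
theorem integral_integral_swap_lines (hG : DifferentiableOn ℂ (fun z : ℂ × ℂ => G z.1 z.2) G₂Region)
    {R : ℝ} (hR : 0 < R) {a b d u v : ℕ} (hau : 1 ≤ a + u) (hbv : 1 ≤ b + v) {σ₁ σ₂ : ℝ}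
    (h1 : 0 < σ₁) (h1' : σ₁ ≤ 1) (h2 : 0 < σ₂) (h2' : σ₂ ≤ 1) (hB0 : 0 ≤ B)
    (hGB : ∀ t₁ t₂ : ℝ, ‖G ((σ₁ : ℂ) + t₁ * I) ((σ₂ : ℂ) + t₂ * I)‖ ≤ B) :
    ∫ t₂ : ℝ, ∫ t₁ : ℝ, lemma3F G R a b d u v ((σ₁ : ℂ) + t₁ * I) ((σ₂ : ℂ) + t₂ * I) =
      ∫ t₁ : ℝ, ∫ t₂ : ℝ, lemma3F G R a b d u v ((σ₁ : ℂ) + t₁ * I) ((σ₂ : ℂ) + t₂ * I) := by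
  have hint : Integrable (Function.uncurry fun t₁ t₂ : ℝ =>
      lemma3F G R a b d u v ((σ₁ : ℂ) + t₁ * I) ((σ₂ : ℂ) + t₂ * I)) (volume.prod volume) :=
    integrable_lemma3F_lines (d := d) hG hR hau hbv h1 h1' h2 h2' hB0 hGB
  exact (MeasureTheory.integral_integral_swap hint).symm

/-- **Moving the `s₁`-line** for fixed `s₂` with `0 < Re s₂ ≤ 1`: for `0 < θ ≤ 1`,
`∫ F(θ+it₁, s₂) dt₁ = ∫ F(1+it₁, s₂) dt₁` (no poles in `θ ≤ Re s₁ ≤ 1`; absolute convergence on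
both lines; uniform decay on horizontal segments). Requires `|G| ≤ B` on `[θ,1] × {s₂}` and `R ≥ 1`.
[cite: GoldstonPintzYildirim2009, Section 8 eq. 8.7] -/
theorem integral_lemma3F_fst_line_eq (hG : DifferentiableOn ℂ (fun z : ℂ × ℂ => G z.1 z.2) G₂Region)
    {R : ℝ} (hR : 1 ≤ R) {a b d u v : ℕ} (hau : 1 ≤ a + u) {θ : ℝ} (hθ : 0 < θ) (hθ1 : θ ≤ 1)
    {s₂ : ℂ} (h2 : 0 < s₂.re) (h2' : s₂.re ≤ 1) (hB0 : 0 ≤ B)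
    (hGB : ∀ s₁ : ℂ, θ ≤ s₁.re → s₁.re ≤ 1 → ‖G s₁ s₂‖ ≤ B) :
    ∫ t₁ : ℝ, lemma3F G R a b d u v ((θ : ℂ) + t₁ * I) s₂ =
      ∫ t₁ : ℝ, lemma3F G R a b d u v (((1 : ℝ) : ℂ) + t₁ * I) s₂ := by
  have hR0 : 0 < R := by linarith
  have hs2 : s₂ ≠ 0 := fun h => by rw [h] at h2; simp at h2
  have hW2 := zetaOne_ne_zero_of_re_pos h2
  -- pointwise bound on the strip
  have hbd : ∀ s₁ : ℂ, θ ≤ s₁.re → s₁.re ≤ 1 →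
      ‖lemma3F G R a b d u v s₁ s₂‖ ≤ B * lineConst θ s₂.re a b d * R ^ 2 * (‖s₂‖ ^ (v + 1 + b))⁻¹ *
        (‖s₁‖ ^ (u + a + 1))⁻¹ := by
    intro s₁ hx hx'
    have hx0 : 0 < s₁.re := hθ.trans_le hx
    have h := norm_lemma3F_le_of_re_pos (G := G) hR0 a b d u v hx0 hx' h2 h2' hB0 (hGB s₁ hx hx')
    refine h.trans ?_
    have hK : lineConst s₁.re s₂.re a b d ≤ lineConst θ s₂.re a b d := by
      unfold lineConst
      gcongr
    have hRle : R ^ (s₁.re + s₂.re) ≤ R ^ (2 : ℝ) := Real.rpow_le_rpow_of_exponent_le hR (by linarith)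
    rw [Real.rpow_two] at hRle
    have hs1 : 0 < ‖s₁‖ := norm_pos_iff.2 (fun h => by rw [h] at hx0; simp at hx0)
    rw [show u + 1 + a = u + a + 1 by ring]
    have hK0 := lineConst_nonneg hθ h2 a b d
    calc B * lineConst s₁.re s₂.re a b d * R ^ (s₁.re + s₂.re) * ((‖s₁‖ ^ (u + a + 1))⁻¹ * (‖s₂‖ ^ (v + 1 + b))⁻¹)
        ≤ B * lineConst θ s₂.re a b d * R ^ 2 * ((‖s₁‖ ^ (u + a + 1))⁻¹ * (‖s₂‖ ^ (v + 1 + b))⁻¹) := by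
          gcongr
      _ = _ := by ring
  set K := B * lineConst θ s₂.re a b d * R ^ 2 * (‖s₂‖ ^ (v + 1 + b))⁻¹ with hKdef
  have hK0 : 0 ≤ K := by
    rw [hKdef]; have := lineConst_nonneg hθ h2 a b d; positivity
  -- differentiability on the closed strip
  have hdiff : DifferentiableOn ℂ (fun s₁ => lemma3F G R a b d u v s₁ s₂) (re ⁻¹' Icc θ 1) := by
    intro s₁ hs
    have hx : θ ≤ s₁.re := hs.1
    have hx0 : 0 < s₁.re := hθ.trans_le hx
    refine (differentiableAt_lemma3F_fst hG hR0 a b d u v (by linarith) (by linarith)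
      (zetaOne_ne_zero_of_re_pos hx0) hW2 ?_ hs2 ?_).differentiableWithinAt
    · intro h; rw [h] at hx0; simp at hx0
    · intro h; have := congrArg Complex.re h; simp at this; linarith
  -- integrability on a line `Re s₁ = x`, `x ∈ [θ, 1]`
  have hint : ∀ x : ℝ, θ ≤ x → x ≤ 1 → Integrable fun t : ℝ => lemma3F G R a b d u v ((x : ℂ) + t * I) s₂ := by
    intro x hx hx'
    have hx0 : 0 < x := hθ.trans_le hx
    obtain ⟨hi, -⟩ := integral_inv_norm_pow_le hx0 (k := u + a) (by omega)
    have hcont : Continuous fun t : ℝ => lemma3F G R a b d u v ((x : ℂ) + t * I) s₂ := by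
      have hc2 := continuous_lemma3F_lines hG hR0 a b d u v hx0 h2
      have : (fun t : ℝ => lemma3F G R a b d u v ((x : ℂ) + t * I) s₂) =
          (fun p : ℝ × ℝ => lemma3F G R a b d u v ((x : ℂ) + p.1 * I) (((s₂.re : ℝ) : ℂ) + p.2 * I)) ∘
            fun t => (t, s₂.im) := by
        funext t; simp only [Function.comp]; congr 1; apply Complex.ext <;> simp
      rw [this]; exact hc2.comp (by fun_prop)
    refine (hi.const_mul K).mono' hcont.aestronglyMeasurable (Eventually.of_forall fun t => ?_)
    have h := hbd ((x : ℂ) + t * I) (by simpa using hx) (by simpa using hx')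
    simpa using h
  -- decay on horizontal segments
  have hdecay : ∀ ε : ℝ, 0 < ε → ∃ T₀ : ℝ, ∀ T : ℝ, T₀ ≤ |T| → ∀ x ∈ Icc θ 1,
      ‖lemma3F G R a b d u v (x + T * I) s₂‖ ≤ ε := by
    intro ε hε
    refine ⟨max 1 (K / ε), fun T hT x hx => ?_⟩
    have hT1 : 1 ≤ |T| := (le_max_left _ _).trans hT
    have hTK : K / ε ≤ |T| := (le_max_right _ _).trans hT
    have h := hbd ((x : ℂ) + T * I) (by simpa using hx.1) (by simpa using hx.2)
    refine h.trans ?_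
    have hnT : |T| ≤ ‖(x : ℂ) + T * I‖ := by simpa using Complex.abs_im_le_norm ((x : ℂ) + T * I)
    have hpow : |T| ≤ ‖(x : ℂ) + T * I‖ ^ (u + a + 1) := by
      calc |T| = |T| ^ 1 := (pow_one _).symm
        _ ≤ |T| ^ (u + a + 1) := pow_le_pow_right₀ hT1 (by omega)
        _ ≤ ‖(x : ℂ) + T * I‖ ^ (u + a + 1) := pow_le_pow_left₀ (abs_nonneg _) hnT _
    have hT0 : 0 < |T| := by linarith
    calc K * (‖(x : ℂ) + T * I‖ ^ (u + a + 1))⁻¹ ≤ K * |T|⁻¹ :=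
          mul_le_mul_of_nonneg_left (inv_anti₀ hT0 hpow) hK0
      _ ≤ ε := by
          rw [← div_eq_mul_inv, div_le_iff₀ hT0]
          rw [div_le_iff₀ hε] at hTK
          linarith
  exact Literature.Analysis.Complex.integral_vertical_eq_of_differentiableOn hθ1 hdiff
    (hint θ le_rfl hθ1) (by simpa using hint 1 hθ1 le_rfl) (by simpa using hdecay)

/-- **Moving the `s₂`-line** for fixed `s₁` with `0 < Re s₁ ≤ 1`: for `0 < θ ≤ 1`,
`∫ F(s₁, θ+it₂) dt₂ = ∫ F(s₁, 1+it₂) dt₂`. [cite: GoldstonPintzYildirim2009, Section 8 eq. 8.7] -/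
theorem integral_lemma3F_snd_line_eq (hG : DifferentiableOn ℂ (fun z : ℂ × ℂ => G z.1 z.2) G₂Region)
    {R : ℝ} (hR : 1 ≤ R) {a b d u v : ℕ} (hbv : 1 ≤ b + v) {θ : ℝ} (hθ : 0 < θ) (hθ1 : θ ≤ 1)
    {s₁ : ℂ} (h1 : 0 < s₁.re) (h1' : s₁.re ≤ 1) (hB0 : 0 ≤ B)
    (hGB : ∀ s₂ : ℂ, θ ≤ s₂.re → s₂.re ≤ 1 → ‖G s₁ s₂‖ ≤ B) :
    ∫ t₂ : ℝ, lemma3F G R a b d u v s₁ ((θ : ℂ) + t₂ * I) =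
      ∫ t₂ : ℝ, lemma3F G R a b d u v s₁ (((1 : ℝ) : ℂ) + t₂ * I) := by
  have hR0 : 0 < R := by linarith
  have hs1 : s₁ ≠ 0 := fun h => by rw [h] at h1; simp at h1
  have hW1 := zetaOne_ne_zero_of_re_pos h1
  have hbd : ∀ s₂ : ℂ, θ ≤ s₂.re → s₂.re ≤ 1 →
      ‖lemma3F G R a b d u v s₁ s₂‖ ≤ B * lineConst s₁.re θ a b d * R ^ 2 * (‖s₁‖ ^ (u + 1 + a))⁻¹ *
        (‖s₂‖ ^ (v + b + 1))⁻¹ := by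
    intro s₂ hx hx'
    have hx0 : 0 < s₂.re := hθ.trans_le hx
    have h := norm_lemma3F_le_of_re_pos (G := G) hR0 a b d u v h1 h1' hx0 hx' hB0 (hGB s₂ hx hx')
    refine h.trans ?_
    have hK : lineConst s₁.re s₂.re a b d ≤ lineConst s₁.re θ a b d := by
      unfold lineConst
      gcongr
    have hRle : R ^ (s₁.re + s₂.re) ≤ R ^ (2 : ℝ) := Real.rpow_le_rpow_of_exponent_le hR (by linarith)
    rw [Real.rpow_two] at hRle
    have hs2 : 0 < ‖s₂‖ := norm_pos_iff.2 (fun h => by rw [h] at hx0; simp at hx0)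
    rw [show v + 1 + b = v + b + 1 by ring]
    have hK0 := lineConst_nonneg h1 hθ a b d
    calc B * lineConst s₁.re s₂.re a b d * R ^ (s₁.re + s₂.re) * ((‖s₁‖ ^ (u + 1 + a))⁻¹ * (‖s₂‖ ^ (v + b + 1))⁻¹)
        ≤ B * lineConst s₁.re θ a b d * R ^ 2 * ((‖s₁‖ ^ (u + 1 + a))⁻¹ * (‖s₂‖ ^ (v + b + 1))⁻¹) := by
          gcongr
      _ = _ := by ring
  set K := B * lineConst s₁.re θ a b d * R ^ 2 * (‖s₁‖ ^ (u + 1 + a))⁻¹ with hKdef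
  have hK0 : 0 ≤ K := by
    rw [hKdef]; have := lineConst_nonneg h1 hθ a b d; positivity
  have hdiff : DifferentiableOn ℂ (fun s₂ => lemma3F G R a b d u v s₁ s₂) (re ⁻¹' Icc θ 1) := by
    intro s₂ hs
    have hx : θ ≤ s₂.re := hs.1
    have hx0 : 0 < s₂.re := hθ.trans_le hx
    refine (differentiableAt_lemma3F_snd hG hR0 a b d u v (by linarith) (by linarith)
      hW1 (zetaOne_ne_zero_of_re_pos hx0) hs1 ?_ ?_).differentiableWithinAt
    · intro h; rw [h] at hx0; simp at hx0
    · intro h; have := congrArg Complex.re h; simp at this; linarith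
  have hint : ∀ x : ℝ, θ ≤ x → x ≤ 1 → Integrable fun t : ℝ => lemma3F G R a b d u v s₁ ((x : ℂ) + t * I) := by
    intro x hx hx'
    have hx0 : 0 < x := hθ.trans_le hx
    obtain ⟨hi, -⟩ := integral_inv_norm_pow_le hx0 (k := v + b) (by omega)
    have hcont : Continuous fun t : ℝ => lemma3F G R a b d u v s₁ ((x : ℂ) + t * I) := by
      have hc2 := continuous_lemma3F_lines hG hR0 a b d u v h1 hx0
      have : (fun t : ℝ => lemma3F G R a b d u v s₁ ((x : ℂ) + t * I)) =
          (fun p : ℝ × ℝ => lemma3F G R a b d u v (((s₁.re : ℝ) : ℂ) + p.1 * I) ((x : ℂ) + p.2 * I)) ∘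
            fun t => (s₁.im, t) := by
        funext t; simp only [Function.comp]; congr 1; apply Complex.ext <;> simp
      rw [this]; exact hc2.comp (by fun_prop)
    refine (hi.const_mul K).mono' hcont.aestronglyMeasurable (Eventually.of_forall fun t => ?_)
    have h := hbd ((x : ℂ) + t * I) (by simpa using hx) (by simpa using hx')
    simpa using h
  have hdecay : ∀ ε : ℝ, 0 < ε → ∃ T₀ : ℝ, ∀ T : ℝ, T₀ ≤ |T| → ∀ x ∈ Icc θ 1,
      ‖lemma3F G R a b d u v s₁ (x + T * I)‖ ≤ ε := by
    intro ε hε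
    refine ⟨max 1 (K / ε), fun T hT x hx => ?_⟩
    have hT1 : 1 ≤ |T| := (le_max_left _ _).trans hT
    have hTK : K / ε ≤ |T| := (le_max_right _ _).trans hT
    have h := hbd ((x : ℂ) + T * I) (by simpa using hx.1) (by simpa using hx.2)
    refine h.trans ?_
    have hnT : |T| ≤ ‖(x : ℂ) + T * I‖ := by simpa using Complex.abs_im_le_norm ((x : ℂ) + T * I)
    have hpow : |T| ≤ ‖(x : ℂ) + T * I‖ ^ (v + b + 1) := by
      calc |T| = |T| ^ 1 := (pow_one _).symm
        _ ≤ |T| ^ (v + b + 1) := pow_le_pow_right₀ hT1 (by omega)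
        _ ≤ ‖(x : ℂ) + T * I‖ ^ (v + b + 1) := pow_le_pow_left₀ (abs_nonneg _) hnT _
    have hT0 : 0 < |T| := by linarith
    calc K * (‖(x : ℂ) + T * I‖ ^ (v + b + 1))⁻¹ ≤ K * |T|⁻¹ :=
          mul_le_mul_of_nonneg_left (inv_anti₀ hT0 hpow) hK0
      _ ≤ ε := by
          rw [← div_eq_mul_inv, div_le_iff₀ hT0]
          rw [div_le_iff₀ hε] at hTK
          linarith
  exact Literature.Analysis.Complex.integral_vertical_eq_of_differentiableOn hθ1 hdiff
    (hint θ le_rfl hθ1) (by simpa using hint 1 hθ1 le_rfl) (by simpa using hdecay)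

/-- **Both lines of (8.1) moved to `Re s₁ = θ₁`, `Re s₂ = θ₂`** (`0 < θᵢ ≤ 1`): if `|G| ≤ B` for
`0 < Re sᵢ ≤ 1` (and `a+u, b+v ≥ 1`, `R ≥ 1`), then
`∫∫ F(1+it₁, 1+it₂) dt₁dt₂ = ∫∫ F(θ₁+it₁, θ₂+it₂) dt₁dt₂` (iterated, `t₁` inside):
the `s₁`-line is moved inside, then Fubini, the `s₂`-line, and Fubini back.
[cite: GoldstonPintzYildirim2009, Section 8 eq. 8.7] -/
theorem integral_integral_lemma3F_lines_eq (hG : DifferentiableOn ℂ (fun z : ℂ × ℂ => G z.1 z.2) G₂Region)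
    {R : ℝ} (hR : 1 ≤ R) {a b d u v : ℕ} (hau : 1 ≤ a + u) (hbv : 1 ≤ b + v) {θ₁ θ₂ : ℝ}
    (hθ₁ : 0 < θ₁) (hθ₁1 : θ₁ ≤ 1) (hθ₂ : 0 < θ₂) (hθ₂1 : θ₂ ≤ 1) (hB0 : 0 ≤ B)
    (hGB : ∀ s₁ s₂ : ℂ, 0 < s₁.re → s₁.re ≤ 1 → 0 < s₂.re → s₂.re ≤ 1 → ‖G s₁ s₂‖ ≤ B) :
    ∫ t₂ : ℝ, ∫ t₁ : ℝ, lemma3F G R a b d u v (((1 : ℝ) : ℂ) + t₁ * I) (((1 : ℝ) : ℂ) + t₂ * I) =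
      ∫ t₂ : ℝ, ∫ t₁ : ℝ, lemma3F G R a b d u v ((θ₁ : ℂ) + t₁ * I) ((θ₂ : ℂ) + t₂ * I) := by
  have hR0 : 0 < R := by linarith
  -- step 1: move `s₁` inside, for each `s₂ = 1 + it₂`
  have h1 : ∀ t₂ : ℝ, ∫ t₁ : ℝ, lemma3F G R a b d u v (((1 : ℝ) : ℂ) + t₁ * I) (((1 : ℝ) : ℂ) + t₂ * I) =
      ∫ t₁ : ℝ, lemma3F G R a b d u v ((θ₁ : ℂ) + t₁ * I) (((1 : ℝ) : ℂ) + t₂ * I) := by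
    intro t₂
    exact (integral_lemma3F_fst_line_eq hG hR hau hθ₁ hθ₁1 (s₂ := ((1 : ℝ) : ℂ) + t₂ * I)
      (by simp) (by simp) hB0 (fun s₁ hx hx' => hGB _ _ (hθ₁.trans_le hx) hx' (by simp) (by simp))).symm
  simp_rw [h1]
  -- step 2: Fubini on `(θ₁) × (1)`
  rw [integral_integral_swap_lines hG hR0 hau hbv hθ₁ hθ₁1 one_pos le_rfl hB0
    (fun t₁ t₂ => hGB _ _ (by simp [hθ₁]) (by simp [hθ₁1]) (by simp) (by simp))]
  -- step 3: move `s₂` inside, for each `s₁ = θ₁ + it₁`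
  have h3 : ∀ t₁ : ℝ, ∫ t₂ : ℝ, lemma3F G R a b d u v ((θ₁ : ℂ) + t₁ * I) (((1 : ℝ) : ℂ) + t₂ * I) =
      ∫ t₂ : ℝ, lemma3F G R a b d u v ((θ₁ : ℂ) + t₁ * I) ((θ₂ : ℂ) + t₂ * I) := by
    intro t₁
    exact (integral_lemma3F_snd_line_eq hG hR hbv hθ₂ hθ₂1 (s₁ := (θ₁ : ℂ) + t₁ * I)
      (by simp [hθ₁]) (by simp [hθ₁1]) hB0 (fun s₂ hx hx' => hGB _ _ (by simp [hθ₁]) (by simp [hθ₁1])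
        (hθ₂.trans_le hx) hx')).symm
  simp_rw [h3]
  -- step 4: Fubini back on `(θ₁) × (θ₂)`
  rw [integral_integral_swap_lines hG hR0 hau hbv hθ₁ hθ₁1 hθ₂ hθ₂1 hB0
    (fun t₁ t₂ => hGB _ _ (by simp [hθ₁]) (by simp [hθ₁1]) (by simp [hθ₂]) (by simp [hθ₂1]))]

end Lines

end Literature.NumberTheory.Sieve.GPY
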